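import Mathlib.GroupTheory.QuotientGroup.Basic
import Mathlib.GroupTheory.Coset.Card
import Mathlib.Algebra.Group.Subgroup.Finite
import Mathlib.SetTheory.Cardinal.Finite
import Mathlib.Data.Set.Card
import Mathlib.Tactic.NormNum
import HarnessLib

/-!
# A finite abelian group has `#G = #G[2] · #(G²)` (the squaring map), and the `2`-rank `h₂` with
# `2^{h₂} · #(G²) = #G` is `2` when `G[2]` has exactly four elements

Cell `bsd-monsky` (typer seat), plumbing for the split of the Gross–Zagier index relation
(`Tian2014/CMPointSystemGrossZagierSplit.lean`): Tian–Yuan–Zhang 2017 print `2^{h₂(n)}` with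
"`h₂(n) = dim_{𝔽₂} Cl_n/2Cl_n`" (p. 756), and Tian 2014 prints "`𝒜[2]` has cardinality `2^{k+1}`"
(Notations (i), J122); the two are tied by the first isomorphism theorem for `x ↦ x²`:
`#G = #ker · #range = #G[2] · #(G²)`. Pure Mathlib; nothing asserted.
[cite: TianYuanZhang2017, §3 (p. 756: "h₂(n) = dim_{𝔽₂} Cl_n/2Cl_n")] [cite: Tian2014, Notations (i) (J122)] [folklore]
-/

noncomputable section

open scoped Classical

namespace Literature.GroupTheory.FiniteAbelian

/-- `#G = #G[2] · #(G²)` for a finite commutative group `G`: `G[2] = {t : t · t = 1}` is the kernel and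
`G² = {a : a is a square}` the range of the squaring homomorphism `powMonoidHom 2` — the identity behind
"`2^{h₂(n)} = #Cl_n/#2Cl_n`, `h₂(n) = dim_{𝔽₂} Cl_n/2Cl_n`" (the character formula `Σ_χ χ(t) = 2^{h₂(n)} δ_{2Cl_n}(t)`).
[cite: TianYuanZhang2017, §3 (p. 756: h₂(n) = dim_{𝔽₂} Cl_n/2Cl_n)] [folklore] -/
theorem card_eq_card_twoTorsion_mul_card_squares (G : Type*) [CommGroup G] [Finite G] :
    Nat.card G = Nat.card {t : G // t * t = 1} * Nat.card {a : G // IsSquare a} := by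
  have hker : Nat.card {t : G // t * t = 1} = Nat.card (powMonoidHom 2 : G →* G).ker := by
    refine Nat.card_congr (Equiv.subtypeEquivRight fun t => ?_)
    simp [MonoidHom.mem_ker, powMonoidHom_apply, sq]
  have hrange : Nat.card {a : G // IsSquare a} = Nat.card (powMonoidHom 2 : G →* G).range := by
    refine Nat.card_congr (Equiv.subtypeEquivRight fun a => ?_)
    simp only [IsSquare, MonoidHom.mem_range, powMonoidHom_apply, sq]
    exact ⟨fun ⟨r, hr⟩ => ⟨r, hr.symm⟩, fun ⟨r, hr⟩ => ⟨r, hr.symm⟩⟩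
  have hquot : Nat.card (G ⧸ (powMonoidHom 2 : G →* G).ker) = Nat.card (powMonoidHom 2 : G →* G).range :=
    Nat.card_congr (QuotientGroup.quotientKerEquivRange (powMonoidHom 2 : G →* G)).toEquiv
  rw [hker, hrange, ← hquot, mul_comm]
  exact Subgroup.card_eq_card_quotient_mul_card_subgroup (powMonoidHom 2 : G →* G).ker

/-- **`h₂ = 2` when `G[2]` has exactly four elements**: if `2^{h₂} · #(G²) = #G` (the printed definition of the
`2`-rank through the genus class number `#(G²)`) and `G[2] = {1, m, a, b}` with `m, a, b` pairwise distinct and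
`≠ 1`, then `h₂ = 2` — "`𝒜[2]` has cardinality `2^{k+1}`" with `k + 1 = 2` ramified odd primes.
[cite: Tian2014, Notations (i) (J122: 𝒜[2] has cardinality 2^{k+1})] [cite: TianYuanZhang2017, §3 (p. 756)] [folklore] -/
theorem twoRank_eq_two_of_twoTorsion_four {G : Type*} [CommGroup G] [Finite G] {h₂ : ℕ}
    (hh : 2 ^ h₂ * Nat.card {a : G // IsSquare a} = Nat.card G) {m a b : G}
    (h2tor : ∀ t : G, t * t = 1 → t = 1 ∨ t = m ∨ t = a ∨ t = b)
    (hm : m * m = 1) (ha : a * a = 1) (hb : b * b = 1) (hm1 : m ≠ 1) (ha1 : a ≠ 1) (hb1 : b ≠ 1)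
    (hma : m ≠ a) (hmb : m ≠ b) (hab : a ≠ b) : h₂ = 2 := by
  have hcard := card_eq_card_twoTorsion_mul_card_squares G
  have h4 : Nat.card {t : G // t * t = 1} = 4 := by
    have hset : {t : G | t * t = 1} = {1, m, a, b} := by
      ext t
      simp only [Set.mem_setOf_eq, Set.mem_insert_iff, Set.mem_singleton_iff]
      constructor
      · exact h2tor t
      · rintro (rfl | rfl | rfl | rfl)
        · simp
        · exact hm
        · exact ha
        · exact hb
    change Nat.card ({t : G | t * t = 1} : Set G) = 4
    rw [Nat.card_coe_set_eq, hset]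
    rw [Set.ncard_insert_of_notMem (by simp [hm1.symm, ha1.symm, hb1.symm]),
      Set.ncard_insert_of_notMem (by simp [hma, hmb]),
      Set.ncard_insert_of_notMem (by simp [hab]), Set.ncard_singleton]
  haveI : Nonempty {a : G // IsSquare a} := ⟨⟨1, ⟨1, by simp⟩⟩⟩
  have hpos : 0 < Nat.card {a : G // IsSquare a} := Nat.card_pos
  have h22 : 2 ^ h₂ = 4 := by
    have : 2 ^ h₂ * Nat.card {a : G // IsSquare a} = 4 * Nat.card {a : G // IsSquare a} := by
      rw [hh, hcard, h4]
    exact Nat.eq_of_mul_eq_mul_right hpos this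
  have h2 : (2 : ℕ) ^ h₂ = 2 ^ 2 := by rw [h22]; norm_num
  exact Nat.pow_right_injective (le_refl 2) h2

end Literature.GroupTheory.FiniteAbelian

end
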